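import Summits.CriticalPhenomena.PercolationContinuityZ3.Theorems.PercNearOneGluingNoHeavyLowerTailOneCutFourBlobsLinear
import HarnessLib

/-!
# Four blobs, sharp constant: reduction of the residual regime to a "two-of-three" lower-tail inequality

Support file for the crux `NoHeavyLowerTail` (stmt-CriticalPhenomena-4575; routes `PercNearOneGluing`,
`PercNearOneGluingNoHeavy`), BLOB-QUOTIENT analysis of the one-cut engine (depth prover nh-dp-blobmono),
continuing `…OneCutThreeBlobs.lean`, `…OneCutFourBlobs.lean`, `…OneCutFourBlobsLinear.lean`.

By those files the one-cut bound with the SHARP constant `1` holds for every four-blob structure except in the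
residual regime: the observer's blob carries a relay and the three other blobs are light.  There the minority
event is `{o reaches at most one of the representatives a, b, c}` and — this file's bookkeeping
(`blobs_expectedCount_le`, `regime_sum_gt_two`) — the regime forces `μ(o↔a) + μ(o↔b) + μ(o↔c) > 2`.  Hence the
sharp four-blob bound follows from the following four-terminal "two-of-three lower-tail" inequality, taken
here as an explicit HYPOTHESIS (`oneCut_of_fourBlobs_of_twoOfThree`; CONDITIONAL result, nothing is claimed
about the hypothesis):

  (T⅔)  for all `o, a, b, c` and `s`: if `μ(o↔a)+μ(o↔b)+μ(o↔c) > 2` and `μ(o↮a), μ(o↮b), μ(o↮c) ≤ s`, then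
        `μ{o misses at least two of a, b, c} ≤ s`.

Status of (T⅔) (recorded for the planners; see the crux notes R4A-RESIDUAL.md): equivalent to
"∃ x ∈ {a,b,c}: μ(S = {x}) ≤ μ(S = {a,b,c}∖{x})" (`S` = relays reached); TRUE for independent attachments as
soon as the sum is `≥ 3/2` (odds argument), with equality for the star with all three `o`-edges `= 1/2`;
no violation in an exhaustive 4-level grid census on `K₅` (2·10⁶ weighted graphs incl. one Steiner vertex) nor
in 10⁶ random weighted `K₆`/`K₇`; it implies the four-blob residual inequality R4a* of
`…OneCutFourBlobs.lean` with the `o`-cuts alone.  It is NOT a consequence of the partition-level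
inequalities C⁺/Harris/lonely-relay (a consistent violating profile of the 15 cell masses exists), so a proof
needs the realizability of the cell masses by bond percolation.
-/

noncomputable section

namespace Summit.CriticalPhenomena.PercolationContinuityZ3.Theorems

open MeasureTheory Set Literature.Probability.LatticeModels Literature.Probability.Percolation
open scoped Classical BigOperators

variable {n : ℕ}

/-- Four-blob bound for the expected count: with representatives `a, b, c` of the three non-observer blobs
(labels pairwise distinct), `E N ≤ m_{cls o} + m_{cls a} μ(o↔a) + m_{cls b} μ(o↔b) + m_{cls c} μ(o↔c)`
(a relay of `x`'s blob is joined to `o` only if `x` is, up to the null set `{relay ↮ x}`). [folklore] -/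
theorem blobs_expectedCount_le (w : Sym2 (Fin n) → unitInterval) (A : Finset (Fin n)) (o a b c : Fin n)
    (cls : Fin n → Fin 4)
    (hcls : ∀ u ∈ insert o A, ∀ v ∈ insert o A, cls u = cls v →
      (prodBernoulli w).real (openConn u v)ᶜ = 0)
    (ha : a ∈ A) (hb : b ∈ A) (hc : c ∈ A)
    (hoa : cls o ≠ cls a) (hob : cls o ≠ cls b) (hoc : cls o ≠ cls c) (hab : cls a ≠ cls b)
    (hac : cls a ≠ cls c) (hbc : cls b ≠ cls c) :
    (∑ d ∈ A, (prodBernoulli w).real (openConn o d)) ≤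
      ((A.filter fun d => cls d = cls o).card : ℝ) +
        ((A.filter fun d => cls d = cls a).card : ℝ) * (prodBernoulli w).real (openConn o a) +
        ((A.filter fun d => cls d = cls b).card : ℝ) * (prodBernoulli w).real (openConn o b) +
        ((A.filter fun d => cls d = cls c).card : ℝ) * (prodBernoulli w).real (openConn o c) := by
  set μ := prodBernoulli w with hμ
  -- relays of `x`'s blob: `μ(o ↔ d) ≤ μ(o ↔ x)`
  have viaRep : ∀ x ∈ A, ∀ d ∈ A, cls d = cls x → μ.real (openConn o d) ≤ μ.real (openConn o x) := by
    intro x hx d hd hdx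
    calc μ.real (openConn o d) ≤ μ.real (openConn o x ∪ (openConn d x)ᶜ) :=
          measureReal_mono fun ω (hω : (openGraph ω).Reachable o d) => by
            by_cases hdx' : (openGraph ω).Reachable d x
            · exact Or.inl (hω.trans hdx')
            · exact Or.inr hdx'
      _ ≤ μ.real (openConn o x) + μ.real (openConn d x)ᶜ := measureReal_union_le _ _
      _ = μ.real (openConn o x) := by
          rw [hcls d (Finset.mem_insert_of_mem hd) x (Finset.mem_insert_of_mem hx) hdx, add_zero]
  -- pointwise bound by a label-indexed step function
  have hpt : ∀ d ∈ A, μ.real (openConn o d) ≤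
      (if cls d = cls o then (1 : ℝ) else 0) +
        μ.real (openConn o a) * (if cls d = cls a then (1 : ℝ) else 0) +
        μ.real (openConn o b) * (if cls d = cls b then (1 : ℝ) else 0) +
        μ.real (openConn o c) * (if cls d = cls c then (1 : ℝ) else 0) := by
    intro d hd
    have h0a : 0 ≤ μ.real (openConn o a) := measureReal_nonneg
    have h0b : 0 ≤ μ.real (openConn o b) := measureReal_nonneg
    have h0c : 0 ≤ μ.real (openConn o c) := measureReal_nonneg
    rcases fin4_exhaust hoa hob hoc hab hac hbc (cls d) with h | h | h | h
    · have h1 : μ.real (openConn o d) ≤ 1 := measureReal_le_one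
      have hda : cls d ≠ cls a := fun e => hoa (h.symm.trans e)
      have hdb : cls d ≠ cls b := fun e => hob (h.symm.trans e)
      have hdc : cls d ≠ cls c := fun e => hoc (h.symm.trans e)
      rw [if_pos h, if_neg hda, if_neg hdb, if_neg hdc]
      linarith
    · have h1 := viaRep a ha d hd h
      have hdo : cls d ≠ cls o := fun e => hoa (e.symm.trans h)
      have hdb : cls d ≠ cls b := fun e => hab (h.symm.trans e)
      have hdc : cls d ≠ cls c := fun e => hac (h.symm.trans e)
      rw [if_neg hdo, if_pos h, if_neg hdb, if_neg hdc]
      linarith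
    · have h1 := viaRep b hb d hd h
      have hdo : cls d ≠ cls o := fun e => hob (e.symm.trans h)
      have hda : cls d ≠ cls a := fun e => hab (e.symm.trans h)
      have hdc : cls d ≠ cls c := fun e => hbc (h.symm.trans e)
      rw [if_neg hdo, if_neg hda, if_pos h, if_neg hdc]
      linarith
    · have h1 := viaRep c hc d hd h
      have hdo : cls d ≠ cls o := fun e => hoc (e.symm.trans h)
      have hda : cls d ≠ cls a := fun e => hac (e.symm.trans h)
      have hdb : cls d ≠ cls b := fun e => hbc (e.symm.trans h)
      rw [if_neg hdo, if_neg hda, if_neg hdb, if_pos h]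
      linarith
  calc (∑ d ∈ A, μ.real (openConn o d))
      ≤ ∑ d ∈ A, ((if cls d = cls o then (1 : ℝ) else 0) +
          μ.real (openConn o a) * (if cls d = cls a then (1 : ℝ) else 0) +
          μ.real (openConn o b) * (if cls d = cls b then (1 : ℝ) else 0) +
          μ.real (openConn o c) * (if cls d = cls c then (1 : ℝ) else 0)) := Finset.sum_le_sum hpt
    _ = _ := by
        rw [Finset.sum_add_distrib, Finset.sum_add_distrib, Finset.sum_add_distrib,
          ← Finset.mul_sum, ← Finset.mul_sum, ← Finset.mul_sum,
          Finset.sum_boole, Finset.sum_boole, Finset.sum_boole, Finset.sum_boole]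
        ring

/-- The residual-regime arithmetic: masses `m₀ ≥ 1`, `m_a, m_b, m_c ≥ 0`, attachment probabilities
`q_x ≥ 0`; if `E N ≤ m₀ + Σ m_x q_x` and every blob is light, `2(m₀ + m_x) < E N`, then
`q_a + q_b + q_c > 2` (use the heaviest blob `x`: `Σ m q ≤ m_x Σ q`). [folklore] -/
theorem regime_sum_gt_two {m0 ma mb mc qa qb qc EN : ℝ} (h0 : 1 ≤ m0) (hma : 0 ≤ ma) (hmb : 0 ≤ mb)
    (hmc : 0 ≤ mc) (hqa : 0 ≤ qa) (hqb : 0 ≤ qb) (hqc : 0 ≤ qc)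
    (hEN : EN ≤ m0 + ma * qa + mb * qb + mc * qc)
    (hla : 2 * (m0 + ma) < EN) (hlb : 2 * (m0 + mb) < EN) (hlc : 2 * (m0 + mc) < EN) :
    2 < qa + qb + qc := by
  by_contra hle
  push Not at hle
  rcases le_total mb ma with hba | hab
  · rcases le_total mc ma with hca | hac
    · -- `a` heaviest
      have h1 : mb * qb ≤ ma * qb := mul_le_mul_of_nonneg_right hba hqb
      have h2 : mc * qc ≤ ma * qc := mul_le_mul_of_nonneg_right hca hqc
      nlinarith
    · -- `c` heaviest
      have h1 : ma * qa ≤ mc * qa := mul_le_mul_of_nonneg_right hac hqa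
      have h2 : mb * qb ≤ mc * qb := mul_le_mul_of_nonneg_right (hba.trans hac) hqb
      nlinarith
  · rcases le_total mc mb with hcb | hbc
    · -- `b` heaviest
      have h1 : ma * qa ≤ mb * qa := mul_le_mul_of_nonneg_right hab hqa
      have h2 : mc * qc ≤ mb * qc := mul_le_mul_of_nonneg_right hcb hqc
      nlinarith
    · -- `c` heaviest
      have h1 : ma * qa ≤ mc * qa := mul_le_mul_of_nonneg_right (hab.trans hbc) hqa
      have h2 : mb * qb ≤ mc * qb := mul_le_mul_of_nonneg_right hbc hqb
      nlinarith

/-- **Sharp four-blob one-cut bound, conditional on the two-of-three lower-tail inequality (T⅔).**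
Hypothesis (for the given weighted graph): for all `o a b c` and `s`, if `μ(o↔a)+μ(o↔b)+μ(o↔c) > 2` and
the three cuts `μ(o↮x) ≤ s`, then `μ{o misses at least two of a,b,c} ≤ s`.  Conclusion: the one-cut bound
with constant `1` for EVERY four-blob structure on this graph.  (Unconditionally the constant is `3/2`,
`oneCut_of_fourBlobs_threeHalves`; the hypothesis is used only in the residual regime.)  CONDITIONAL — the
hypothesis is an open four-terminal inequality (true for independent attachments, tight at the star with
`o`-edges `1/2`; no violation in the census recorded in the module docstring). [folklore] -/
theorem oneCut_of_fourBlobs_of_twoOfThree (n : ℕ) (w : Sym2 (Fin n) → unitInterval)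
    (hT23 : ∀ (o a b c : Fin n) (s : ℝ),
      2 < (prodBernoulli w).real (openConn o a) + (prodBernoulli w).real (openConn o b) +
          (prodBernoulli w).real (openConn o c) →
      (prodBernoulli w).real (openConn o a)ᶜ ≤ s → (prodBernoulli w).real (openConn o b)ᶜ ≤ s →
      (prodBernoulli w).real (openConn o c)ᶜ ≤ s →
      (prodBernoulli w).real ((((openConn o a)ᶜ ∩ (openConn o b)ᶜ) ∪ ((openConn o a)ᶜ ∩ (openConn o c)ᶜ)) ∪
        ((openConn o b)ᶜ ∩ (openConn o c)ᶜ)) ≤ s)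
    (A : Finset (Fin n)) (o : Fin n) (t : ℝ) (cls : Fin n → Fin 4)
    (hcls : ∀ u ∈ insert o A, ∀ v ∈ insert o A, cls u = cls v →
      (prodBernoulli w).real (openConn u v)ᶜ = 0)
    (ht : 0 ≤ t)
    (hpair : ∀ a ∈ A, ∀ a' ∈ A, a ≠ a' → (prodBernoulli w).real (openConn a a')ᶜ ≤ t) :
    (prodBernoulli w).real {ω : BondConfig (Fin n) |
        1 ≤ (A.filter fun a => ω ∈ openConn o a).card ∧
        ((A.filter fun a => ω ∈ openConn o a).card : ℝ) <
          (∑ a ∈ A, (prodBernoulli w).real (openConn o a)) / 2} ≤ t := by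
  set μ := prodBernoulli w with hμ
  set EN := ∑ a ∈ A, μ.real (openConn o a) with hEN
  set m : Fin 4 → ℕ := fun i => (A.filter fun a => cls a = i).card with hm
  have hTle : EN / 2 ≤ (A.card : ℝ) / 2 := by
    have := expectedCount_le_card w A o
    linarith
  -- (1) an unused non-observer label: three blobs
  by_cases hdeg : ∃ i : Fin 4, i ≠ cls o ∧ ∀ a ∈ A, cls a ≠ i
  · obtain ⟨i, hi, hempty⟩ := hdeg
    exact oneCut_of_fourBlobs_of_emptyLabel w A o t cls hcls i hi hempty ht hpair
  push Not at hdeg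
  -- (2) observer-free
  by_cases hfree : ∀ a ∈ A, cls a ≠ cls o
  · exact oneCut_of_fourBlobs_observerFree n w A o t cls hcls hfree ht hpair
  push Not at hfree
  obtain ⟨x₀, hx₀, hcx₀⟩ := hfree
  -- (3) a heavy blob
  by_cases hheavy : ∃ y ∈ A, cls y ≠ cls o ∧
      EN / 2 ≤ ((A.filter fun a => cls a = cls o).card : ℝ) + ((A.filter fun a => cls a = cls y).card : ℝ)
  · obtain ⟨y, hy, hcy, hh⟩ := hheavy
    exact oneCut_of_blobs_heavy w A o t cls hcls hx₀ hcx₀ hy hcy hh hpair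
  push Not at hheavy
  -- (4) residual regime; representatives
  obtain ⟨j, k, l, hj, hk, hl, hjk, hjl, hkl⟩ : ∃ j k l : Fin 4, j ≠ cls o ∧ k ≠ cls o ∧ l ≠ cls o ∧
      j ≠ k ∧ j ≠ l ∧ k ≠ l := by
    generalize cls o = i
    revert i
    decide
  obtain ⟨a, ha, hca⟩ := hdeg j hj
  obtain ⟨b, hb, hcb⟩ := hdeg k hk
  obtain ⟨c, hc, hcc⟩ := hdeg l hl
  have hao : cls a ≠ cls o := by rw [hca]; exact hj
  have hbo : cls b ≠ cls o := by rw [hcb]; exact hk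
  have hco : cls c ≠ cls o := by rw [hcc]; exact hl
  have hcab : cls a ≠ cls b := by rw [hca, hcb]; exact hjk
  have hcac : cls a ≠ cls c := by rw [hca, hcc]; exact hjl
  have hcbc : cls b ≠ cls c := by rw [hcb, hcc]; exact hkl
  have hxa : x₀ ≠ a := fun h => hao (by rw [← h, hcx₀])
  have hxb : x₀ ≠ b := fun h => hbo (by rw [← h, hcx₀])
  have hxc : x₀ ≠ c := fun h => hco (by rw [← h, hcx₀])
  -- masses and the regime inequalities
  have hm0 : (1 : ℝ) ≤ (m (cls o) : ℝ) := by
    have : 1 ≤ m (cls o) := Finset.card_pos.2 ⟨x₀, Finset.mem_filter.2 ⟨hx₀, hcx₀⟩⟩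
    exact_mod_cast this
  have hENle := blobs_expectedCount_le w A o a b c cls hcls ha hb hc (Ne.symm hao) (Ne.symm hbo) (Ne.symm hco)
    hcab hcac hcbc
  have hla := hheavy a ha hao
  have hlb := hheavy b hb hbo
  have hlc := hheavy c hc hco
  have hsum : 2 < μ.real (openConn o a) + μ.real (openConn o b) + μ.real (openConn o c) := by
    refine regime_sum_gt_two (EN := EN) (m0 := (m (cls o) : ℝ)) (ma := (m (cls a) : ℝ))
      (mb := (m (cls b) : ℝ)) (mc := (m (cls c) : ℝ)) hm0 (Nat.cast_nonneg _) (Nat.cast_nonneg _)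
      (Nat.cast_nonneg _) measureReal_nonneg measureReal_nonneg measureReal_nonneg ?_ ?_ ?_ ?_
    · simpa [hm] using hENle
    · have := hla; simp only [hm] at this ⊢; linarith
    · have := hlb; simp only [hm] at this ⊢; linarith
    · have := hlc; simp only [hm] at this ⊢; linarith
  -- the `o`-cuts are at most `t` (through the relay `x₀` of the observer's blob)
  have hox0 : μ.real (openConn o x₀)ᶜ = 0 :=
    hcls o (Finset.mem_insert_self _ _) x₀ (Finset.mem_insert_of_mem hx₀) hcx₀.symm
  have ocut : ∀ y ∈ A, x₀ ≠ y → μ.real (openConn o y)ᶜ ≤ t := by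
    intro y hy hxy
    calc μ.real (openConn o y)ᶜ ≤ μ.real ((openConn x₀ y)ᶜ ∪ (openConn o x₀)ᶜ) :=
          measureReal_mono fun ω (hω : ¬ (openGraph ω).Reachable o y) => by
            by_cases h : (openGraph ω).Reachable o x₀
            · exact Or.inl fun h' => hω (h.trans h')
            · exact Or.inr h
      _ ≤ μ.real (openConn x₀ y)ᶜ + μ.real (openConn o x₀)ᶜ := measureReal_union_le _ _
      _ ≤ t := by rw [hox0, add_zero]; exact hpair x₀ hx₀ y hy hxy
  -- every pair of other blobs is heavy
  have hpairs : ∀ y z u : Fin n, y ∈ A → z ∈ A → u ∈ A → cls y ≠ cls o → cls z ≠ cls o → cls u ≠ cls o →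
      cls y ≠ cls z → cls y ≠ cls u → cls z ≠ cls u →
      EN / 2 ≤ (m (cls o) : ℝ) + (m (cls y) : ℝ) + (m (cls z) : ℝ) := by
    intro y z u hy hz hu hyo hzo huo hyz hyu hzu
    by_contra hlt
    push Not at hlt
    have hcard := blobs_card_le_four A o y z u cls (Ne.symm hyo) (Ne.symm hzo) (Ne.symm huo) hyz hyu hzu
    have hcard' : (A.card : ℝ) ≤ (m (cls o) : ℝ) + (m (cls y) : ℝ) + (m (cls z) : ℝ) + (m (cls u) : ℝ) := by
      exact_mod_cast hcard
    have hu_light := hheavy u hu huo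
    have hm0' : (0 : ℝ) ≤ (m (cls o) : ℝ) := Nat.cast_nonneg _
    have : (m (cls u) : ℝ) < EN / 2 := by
      have := hu_light; simp only [hm] at this ⊢; linarith
    linarith
  -- the trap: `o` misses at least two of `a, b, c`
  set Da := ((openConn o a)ᶜ : Set (BondConfig (Fin n))) with hDa
  set Db := ((openConn o b)ᶜ : Set (BondConfig (Fin n))) with hDb
  set Dc := ((openConn o c)ᶜ : Set (BondConfig (Fin n))) with hDc
  have hE : μ.real ((Da ∩ Db) ∪ (Da ∩ Dc) ∪ (Db ∩ Dc)) ≤ t :=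
    hT23 o a b c t hsum (ocut a ha hxa) (ocut b hb hxb) (ocut c hc hxc)
  refine oneCut_of_blobs_trap w A o t cls hcls _ ((Da ∩ Db) ∪ (Da ∩ Dc) ∪ (Db ∩ Dc)) (fun ω hω => ?_) hE
  obtain ⟨⟨h1, hNlt⟩, hωG⟩ := hω
  have key : ∀ y z u : Fin n, y ∈ A → z ∈ A → u ∈ A → cls y ≠ cls o → cls z ≠ cls o → cls u ≠ cls o →
      cls y ≠ cls z → cls y ≠ cls u → cls z ≠ cls u →
      (openGraph ω).Reachable o y → (openGraph ω).Reachable o z → False := by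
    intro y z u hy hz hu hyo hzo huo hyz hyu hzu hoy hoz
    have hge := blobs_count_ge_three A o cls ω hωG hy hz hoy hoz hyo hzo hyz
    have hge' : (m (cls o) : ℝ) + (m (cls y) : ℝ) + (m (cls z) : ℝ) ≤
        ((A.filter fun d => ω ∈ openConn o d).card : ℝ) := by exact_mod_cast hge
    have := hpairs y z u hy hz hu hyo hzo huo hyz hyu hzu
    linarith
  have mem : ∀ x y : Fin n, ω ∈ (openConn x y : Set (BondConfig (Fin n))) ↔
      (openGraph ω).Reachable x y := fun _ _ => Iff.rfl
  simp only [hDa, hDb, hDc, mem_union, mem_inter_iff, mem_compl_iff, mem]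
  by_cases hA : (openGraph ω).Reachable o a
  · by_cases hB : (openGraph ω).Reachable o b
    · exact absurd (key a b c ha hb hc hao hbo hco hcab hcac hcbc hA hB) id
    · by_cases hC : (openGraph ω).Reachable o c
      · exact absurd (key a c b ha hc hb hao hco hbo hcac hcab (Ne.symm hcbc) hA hC) id
      · exact Or.inr ⟨hB, hC⟩
  · by_cases hB : (openGraph ω).Reachable o b
    · by_cases hC : (openGraph ω).Reachable o c
      · exact absurd (key b c a hb hc ha hbo hco hao hcbc (Ne.symm hcab) (Ne.symm hcac) hB hC) id
      · exact Or.inl (Or.inr ⟨hA, hC⟩)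
    · exact Or.inl (Or.inl ⟨hA, hB⟩)

end Summit.CriticalPhenomena.PercolationContinuityZ3.Theorems

end
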